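import Mathlib

/-!
# Door D7, exact half: the typed conjecture HALL-6 and what it buys

Context (`SoloInformedCwTwoValueWeights`, `SoloInformedCwTwoPairingDesigns`, `SoloInformedCwTwoOnePairClosure`):
a monomial degeneration of `T_{cw,2}^{⊠N}` into `ℂ[x]/(x^{σ+1})` is an integer weighted design with digit pairs
`(s_k < d_k)`, cost `σ = ∑ (s_k + d_k)`; a prefix of a design is a *mixed* system with `p` complete pairs and `q`
singletons `t_i`.  D7-CLOSURE (`σ ≥ 4^N - 1`, i.e. such degenerations never beat border rank `4^N`) follows from
MIXED CLOSURE `σ ≥ 2^(2p+q) - 1`, proved for `p ≤ 1` (Theorem A, `onePair_mixed_closure`) and refuted for none.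

This file TYPES the conjecture that carries the general case in the seat's analysis (CLAIMS c144, gen 13) and proves
the (easy) implication to the closure bound, so that the open half of the door is one named `Prop`:

**HALL-6.**  Index the `4^p · 2^q` *binary words* by a letter `w k ∈ {0, s, d, s+d}` per pair and a subset of the
singletons.  A word may REPRESENT itself by its value, except that every letter `s_k + d_k` may independently be
traded for `2 s_k` or for `2 d_k` (the three form an arithmetic progression of step `d_k - s_k`); representatives
must lie in `[0, σ]`.  HALL-6 asserts that the words admit pairwise distinct representatives (a system of distinct
representatives for the candidate sets).  Equivalently (Edmonds): the multiplication map
`⊗_k span{1, z^{s_k}, z^{d_k}, α_k z^{2s_k} + β_k z^{s_k+d_k} + γ_k z^{2d_k}} ⊗ ⊗_i span{1, z^{t_i}} → ℚ[z]/(z^{σ+1})`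
is injective for generic units.  For `p ≤ 1` the trade `s+d ↦ 2s` alone suffices (Theorem A); from `p = 2` on it
does not (e.g. the design `(3,4 | 6,8 ; 17)`), while no mixed design violating HALL-6 is known (0 of ≈ 35 000,
jobs j115203 and earlier beds).  `hallSix_closure` below: HALL-6 ⟹ `2^(2p+q) ≤ σ + 1`.

Written by the solo-informed seat (gen 13); standard axioms only.
-/

namespace Summit.MatrixMultiplication.MatrixMultiplication.Theorems

open Finset

/-- Binary words of a mixed system: a letter in `{0, s, d, s+d}` (coded `0,1,2,3`) per pair, a subset of singletons. -/
abbrev HWord (p q : ℕ) := (Fin p → Fin 4) × Finset (Fin q)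

/-- The cost `σ = ∑ (s_k + d_k) + ∑ t_i` of a mixed system. -/
def mixedSigma {p q : ℕ} (s d : Fin p → ℕ) (t : Fin q → ℕ) : ℕ := (∑ k, (s k + d k)) + ∑ i, t i

/-- Value of the representative of the word `m` chosen by `ε`: at a pair carrying the letter `s+d` (code `3`) the
choice `ε k ∈ {0,1,2}` selects `2s`, `s+d` or `2d`; elsewhere the letter value; plus the singleton subset sum. -/
def candVal {p q : ℕ} (s d : Fin p → ℕ) (t : Fin q → ℕ) (m : HWord p q) (ε : Fin p → Fin 3) : ℕ :=
  (∑ k, (if m.1 k = 3 then (![2 * s k, s k + d k, 2 * d k] : Fin 3 → ℕ) (ε k)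
          else (![0, s k, d k, s k + d k] : Fin 4 → ℕ) (m.1 k))) + ∑ i ∈ m.2, t i

/-- **HALL-6** for the mixed system `(s, d ; t)`: a choice of representative per word, all in `[0, σ]`, pairwise
distinct. -/
def HallSix {p q : ℕ} (s d : Fin p → ℕ) (t : Fin q → ℕ) : Prop :=
  ∃ ε : HWord p q → (Fin p → Fin 3),
    (∀ m, candVal s d t m (ε m) ≤ mixedSigma s d t) ∧
    Function.Injective (fun m => candVal s d t m (ε m))

/-- HALL-6 implies MIXED CLOSURE for the system: `4^p · 2^q ≤ σ + 1`. -/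
theorem hallSix_closure {p q : ℕ} (s d : Fin p → ℕ) (t : Fin q → ℕ) (h : HallSix s d t) :
    4 ^ p * 2 ^ q ≤ mixedSigma s d t + 1 := by
  classical
  obtain ⟨ε, hle, hinj⟩ := h
  let f : HWord p q → Fin (mixedSigma s d t + 1) :=
    fun m => ⟨candVal s d t m (ε m), Nat.lt_succ_of_le (hle m)⟩
  have hf : Function.Injective f := by
    intro a b hab
    exact hinj (by simpa [f] using congrArg Fin.val hab)
  have hcard := Fintype.card_le_of_injective f hf
  simpa [HWord, Fintype.card_prod, Fintype.card_fun, Fintype.card_finset, Fintype.card_fin] using hcard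

/-- Allowed relations of a mixed system: per pair a pattern `(a_k, b_k)` with `a_k, b_k ≥ -1`, `a_k + b_k ≤ 1`
(the differences of the degree-3 letters), per singleton a coefficient in `{-1, 0, 1}`. -/
def IsAllowedRelation {p q : ℕ} (a b : Fin p → ℤ) (c : Fin q → ℤ) : Prop :=
  (∀ k, -1 ≤ a k ∧ -1 ≤ b k ∧ a k + b k ≤ 1) ∧ (∀ i, -1 ≤ c i ∧ c i ≤ 1)

/-- **Mixed design** (the vertex / Gordan form of door D7 for a prefix with `p` complete pairs `s_k < d_k` and `q`
singletons `t_i`): there are integer weights making every nonzero allowed relation of value `0` strictly positive —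
equivalently, no nonempty family of allowed value-`0` relations sums to zero. -/
def IsMixedDesign {p q : ℕ} (s d : Fin p → ℕ) (t : Fin q → ℕ) : Prop :=
  (∀ k, s k < d k) ∧
  ∃ (ys yd : Fin p → ℤ) (yt : Fin q → ℤ), ∀ (a b : Fin p → ℤ) (c : Fin q → ℤ),
    IsAllowedRelation a b c →
    (∑ k, (a k * (s k : ℤ) + b k * (d k : ℤ))) + ∑ i, c i * (t i : ℤ) = 0 →
    (a ≠ 0 ∨ b ≠ 0 ∨ c ≠ 0) →
    1 ≤ (∑ k, (a k * ys k + b k * yd k)) + ∑ i, c i * yt i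

/-- **The HALL-6 conjecture** (CLAIMS c144): every mixed design satisfies HALL-6.  (Conjecture; a `Prop`, never
assumed globally.  Proved for `p ≤ 1` in the form of `onePair_mixed_closure`; open from `p = 2`.) -/
def HallSixConjecture : Prop :=
  ∀ {p q : ℕ} (s d : Fin p → ℕ) (t : Fin q → ℕ), IsMixedDesign s d t → HallSix s d t

/-- Under HALL-6, every mixed design obeys MIXED CLOSURE `4^p · 2^q ≤ σ + 1`; with `q = 0`, `p = N` this is
D7-closure `4^N ≤ σ + 1` for every integer weighted design, i.e. no monomial degeneration of `T_{cw,2}^{⊠N}` into a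
truncated polynomial ring beats border rank `4^N`. -/
theorem mixedClosure_of_hallSixConjecture (hconj : HallSixConjecture) {p q : ℕ} (s d : Fin p → ℕ)
    (t : Fin q → ℕ) (hD : IsMixedDesign s d t) : 4 ^ p * 2 ^ q ≤ mixedSigma s d t + 1 :=
  hallSix_closure s d t (hconj s d t hD)

end Summit.MatrixMultiplication.MatrixMultiplication.Theorems
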